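import Summits.AtomisticToContinuum.HydrodynamicLimit.Theorems.StiffCollisionalRelaxationAprioriBoundsTruncationTools
import Literature.Barriers.AtomisticToContinuum.HighMomentumCutoff
import HarnessLib

/-!
# Component (i) of the a-priori crux from Gaussian velocity tails in the mean plus a fixed-time velocity LLN
(stub `partOneOfTails`)

Supporting file of the line `Sketch` for the crux `AprioriBounds` (stmt-AtomisticToContinuum-14827;
`StiffCollisionalRelaxation.AprioriBounds` = `CollisionIsometryCLT.AprioriBoundsPreShock`), lead prover
`prover-line-stmt-AtomisticToContinuum-14827-c4-0`, reshape r7 of component (i).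

Component (i) asks, with probability `→ 1`, a FIXED bound on the time-averaged empirical exponential velocity
moment `∫₀ᵗ (N+1)⁻¹∑ᵢ e^{λ|vᵢ(s)|²} ds`.  Reshape r7 splits it into its two logically independent contents:
(tails) an EXPECTED Gaussian moment at some rate `c` along the flow, uniformly in `N ≥ N₀` and `s ≤ t`
(Nachtergaele–Yau's high-momentum cutoff II.1, the observable `expVelocityMoment c` of the barrier file
`HighMomentumCutoff`; = the body of the item `SpeedCapSurgery.GaussianVelocityTails`), and (concentration) convergence in
probability, at every fixed time, of the TRUNCATED averages `(N+1)⁻¹∑ᵢ (e^{(c/2)|vᵢ(s)|²} ∧ K)` to some constant.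
This file proves the glue `stub_partOneOfTails`: tails + concentration ⟹ (i) with `λ = c/2` and threshold
`t·C + 1`, for the local Gibbs laws of any continuous positive profiles at any `0 < σ ≤ 1/2` and any family of
hard-sphere flows (no Euler solution enters).  The model-independent steps (convergence in probability ⇒ `L¹` for
bounded variables, centring at the mean, the truncation inequality, joint a.e.-measurability along the flow,
dominated convergence on the window, and the Markov–Tonelli bound `measure_timeAvg_gt_le_of_trunc`) are in
`…AprioriBoundsTruncationTools.lean`.

## Proof

Fix `K > 0` and write `aᵢ = e^{(c/2)|vᵢ|²} ≥ 1`, `G = (N+1)⁻¹∑aᵢ`, `W = (N+1)⁻¹∑(aᵢ ∧ K) ∈ [0, K]`,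
`G₂ = (N+1)⁻¹∑aᵢ² = (N+1)⁻¹∑e^{c|vᵢ|²}`.  Pointwise `0 ≤ G − W ≤ G₂/K` (from `a − a ∧ K ≤ a²/K`) and `W ≤ G₂`.
Centre `W(Φ_s z)` at its mean `e(s) = E W(Φ_s ·) ≤ C` (measurable in `s` up to a null set, by Tonelli on
`good × [0,t]`).  On a good orbit `∫₀ᵗ G = ∫₀ᵗ (W − e) + ∫₀ᵗ e + ∫₀ᵗ (G − W) ≤ ∫₀ᵗ |W − e| + tC + ∫₀ᵗ (G − W)`, so the
bad event `{tC + 1 < ∫₀ᵗ G}` forces `1 ≤ Y(z) = ∫₀ᵗ (|W − e| + G₂/K)(Φ_s z) ds`; Markov and Tonelli give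
`P(bad) ≤ ∫₀ᵗ E|W(Φ_s ·) − e(s)| ds + tC/K`.  The integrand of the first term is `≤ K` and tends to `0` for every
`s` (bounded variables converging in probability to a constant converge in `L¹`, and centring at the mean costs a
factor `2`), so the first term tends to `0` by dominated convergence; hence `limsup_N P(bad) ≤ tC/K` for every `K`.

No new definitions, no named facts; axioms `propext`, `Classical.choice`, `Quot.sound`.
-/

noncomputable section

open MeasureTheory Filter Set Topology
open scoped ENNReal

namespace Summit.AtomisticToContinuum.HydrodynamicLimit.Theorems.AdiabatCeiling

open Literature.MathematicalPhysics.KineticTheory Literature.Analysis.FluidPDE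
open Literature.Barriers.AtomisticToContinuum (expVelocityMoment)

/-- STUB `partOneOfTails` of the line `Sketch` (reshape r7, cycle 5; PROVED): **an expected Gaussian velocity
moment at rate `c` along the flow, uniformly in `N ≥ N₀` and `s ≤ t`, plus convergence in probability of the
truncated averages `(N+1)⁻¹∑ᵢ (e^{(c/2)|vᵢ(s)|²} ∧ K)` at every fixed time `s ≤ t` and every level `K`, imply
component (i) of the crux with `λ = c/2` and threshold `t·C + 1`:
`P_N{t·C + 1 < ∫₀ᵗ (N+1)⁻¹∑ᵢ e^{(c/2)|vᵢ(s)|²} ds} → 0`.**  For the local Gibbs laws of any continuous profiles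
`a₀, θ₀ > 0`, `u₀`, any `0 < σ ≤ 1/2` and any family of hard-sphere flows. -/
theorem stub_partOneOfTails :
    ∀ (a₀ θ₀ : T3 → ℝ) (u₀ : T3 → V3), Continuous a₀ → Continuous θ₀ → Continuous u₀ →
      (∀ x, 0 < a₀ x) → (∀ x, 0 < θ₀ x) →
      ∀ (σ : ℝ), 0 < σ → σ ≤ 1 / 2 →
      ∀ (Φ : (N : ℕ) → HardSphereFlow (Torus.geometry (Fin 3)) (hsDiameter σ N) (N + 1))
        (t c : ℝ) (C : ℝ≥0∞) (N₀ : ℕ), 0 < t → 0 < c → C < ⊤ →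
        (∀ N : ℕ, N₀ ≤ N → ∀ s ∈ Icc 0 t,
          ∫⁻ z, Literature.Barriers.AtomisticToContinuum.expVelocityMoment c ((Φ N).flow s z)
            ∂(localGibbsLaw σ a₀ u₀ θ₀ N (Φ N)) ≤ C) →
        (∀ K : ℝ, ∀ s ∈ Icc 0 t, ∃ m : ℝ, ∀ δ : ℝ, 0 < δ →
          Tendsto (fun N : ℕ => localGibbsLaw σ a₀ u₀ θ₀ N (Φ N)
            {z | δ < |(∫ y, min (Real.exp (c / 2 * ‖y.2‖ ^ 2)) K ∂(empiricalMeasure ((Φ N).flow s z))) - m|})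
            atTop (𝓝 0)) →
        Tendsto (fun N : ℕ => localGibbsLaw σ a₀ u₀ θ₀ N (Φ N)
          {z | t * C.toReal + 1 < ∫ s in Icc 0 t, ∫ y, Real.exp (c / 2 * ‖y.2‖ ^ 2)
            ∂(empiricalMeasure ((Φ N).flow s z))}) atTop (𝓝 0) := by
  intro a₀ θ₀ u₀ ha hθ hu ha0 hθ0 σ _hσ hσ2 Φ t c C N₀ ht hc hC htails hlln
  set P : (N : ℕ) → Measure (Config (N + 1) (Fin 3) T3) := fun N => localGibbsLaw σ a₀ u₀ θ₀ N (Φ N) with hP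
  haveI hprob : ∀ N, IsProbabilityMeasure (P N) := fun N =>
    isProbabilityMeasure_localGibbsLaw ha hθ hu ha0 hθ0 hσ2 N (Φ N)
  have hgood0 : ∀ N, P N (Φ N).goodᶜ = 0 := fun N => by
    simp only [hP]
    rw [localGibbsLaw_eq]
    exact (localGibbsMeasure_absolutelyContinuous σ _ _ _ N (Φ N)) (Φ N).measure_compl_good
  set ν : Measure ℝ := volume.restrict (Icc 0 t) with hν
  refine ENNReal.tendsto_nhds_zero.2 fun ε hε => ?_
  rcases eq_top_or_lt_top ε with rfl | hεtop
  · exact Eventually.of_forall fun N => le_top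
  -- the truncation level `K`, chosen so that `(C/K)·t ≤ ε/2`
  have hε0 : 0 < ε.toReal := ENNReal.toReal_pos hε.ne' hεtop.ne
  set K : ℝ := 2 * C.toReal * t / ε.toReal + 1 with hKdef
  have hK : 0 < K := by positivity
  have hCK : C / ENNReal.ofReal K * ENNReal.ofReal t ≤ ε / 2 := by
    have h2 : ε / 2 = ENNReal.ofReal (ε.toReal / 2) := by
      rw [ENNReal.ofReal_div_of_pos two_pos, ENNReal.ofReal_toReal hεtop.ne, ENNReal.ofReal_ofNat]
    rw [← ENNReal.ofReal_toReal hC.ne, ← ENNReal.ofReal_div_of_pos hK, ← ENNReal.ofReal_mul (by positivity),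
      h2]
    refine ENNReal.ofReal_le_ofReal ?_
    rw [div_mul_eq_mul_div, div_le_iff₀ hK]
    have hKε : ε.toReal / 2 * K = C.toReal * t + ε.toReal / 2 := by
      rw [hKdef]
      field_simp
    rw [hKε]
    linarith
  -- the observables at level `K`
  set G : (N : ℕ) → Config (N + 1) (Fin 3) T3 → ℝ :=
    fun N w => ((N + 1 : ℕ) : ℝ)⁻¹ * ∑ i, Real.exp (c / 2 * ‖(w i).2‖ ^ 2) with hG
  set W : (N : ℕ) → Config (N + 1) (Fin 3) T3 → ℝ :=
    fun N w => ((N + 1 : ℕ) : ℝ)⁻¹ * ∑ i, min (Real.exp (c / 2 * ‖(w i).2‖ ^ 2)) K with hW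
  have hGm : ∀ N, Measurable (G N) := fun N =>
    measurable_const.mul (Finset.measurable_sum _ fun i _ =>
      ((measurable_pi_apply i).snd.norm.pow_const 2 |>.const_mul (c / 2)).exp)
  have hWm : ∀ N, Measurable (W N) := fun N =>
    measurable_const.mul (Finset.measurable_sum _ fun i _ =>
      ((measurable_pi_apply i).snd.norm.pow_const 2 |>.const_mul (c / 2)).exp.min measurable_const)
  have hMm : ∀ N, Measurable (fun w : Config (N + 1) (Fin 3) T3 => expVelocityMoment c w) := fun N =>
    (measurable_const.mul (Finset.measurable_sum _ fun i _ =>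
      ((measurable_pi_apply i).snd.norm.pow_const 2 |>.const_mul c).exp)).ennreal_ofReal
  have hGemp : ∀ N (w : Config (N + 1) (Fin 3) T3),
      ∫ y, Real.exp (c / 2 * ‖y.2‖ ^ 2) ∂(empiricalMeasure w) = G N w := fun N w => by
    simp only [hG, integral_empiricalMeasure]
  have hWemp : ∀ N (w : Config (N + 1) (Fin 3) T3),
      ∫ y, min (Real.exp (c / 2 * ‖y.2‖ ^ 2)) K ∂(empiricalMeasure w) = W N w := fun N w => by
    simp only [hW, integral_empiricalMeasure]
  -- pointwise facts
  have hW0 : ∀ N w, 0 ≤ W N w := fun N w =>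
    mul_nonneg (by positivity) (Finset.sum_nonneg fun i _ => le_min (Real.exp_pos _).le hK.le)
  have hWK : ∀ N w, W N w ≤ K := fun N w => by
    simp only [hW]
    calc ((N + 1 : ℕ) : ℝ)⁻¹ * ∑ i, min (Real.exp (c / 2 * ‖(w i).2‖ ^ 2)) K
        ≤ ((N + 1 : ℕ) : ℝ)⁻¹ * ∑ _i : Fin (N + 1), K :=
          mul_le_mul_of_nonneg_left (Finset.sum_le_sum fun i _ => min_le_right _ _) (by positivity)
      _ = K := by
          rw [Finset.sum_const, Finset.card_univ, Fintype.card_fin, nsmul_eq_mul, ← mul_assoc,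
            inv_mul_cancel₀ (by positivity), one_mul]
  have hWG : ∀ N w, W N w ≤ G N w := fun N w =>
    mul_le_mul_of_nonneg_left (Finset.sum_le_sum fun i _ => min_le_left _ _) (by positivity)
  have hsq : ∀ v : V3, Real.exp (c / 2 * ‖v‖ ^ 2) ^ 2 = Real.exp (c * ‖v‖ ^ 2) := fun v => by
    rw [sq, ← Real.exp_add]
    ring_nf
  have hrem : ∀ N (w : Config (N + 1) (Fin 3) T3),
      ENNReal.ofReal (G N w - W N w) ≤ expVelocityMoment c w / ENNReal.ofReal K := by
    intro N w
    have hle : G N w - W N w ≤ ((N + 1 : ℕ) : ℝ)⁻¹ * ∑ i, Real.exp (c * ‖(w i).2‖ ^ 2) / K := by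
      simp only [hG, hW]
      rw [← mul_sub, ← Finset.sum_sub_distrib]
      refine mul_le_mul_of_nonneg_left (Finset.sum_le_sum fun i _ => ?_) (by positivity)
      have h := sub_min_le_sq_div (a := Real.exp (c / 2 * ‖(w i).2‖ ^ 2)) hK
      rwa [hsq] at h
    calc ENNReal.ofReal (G N w - W N w)
        ≤ ENNReal.ofReal (((N + 1 : ℕ) : ℝ)⁻¹ * ∑ i, Real.exp (c * ‖(w i).2‖ ^ 2) / K) :=
          ENNReal.ofReal_le_ofReal hle
      _ = ENNReal.ofReal ((((N + 1 : ℕ) : ℝ)⁻¹ * ∑ i, Real.exp (c * ‖(w i).2‖ ^ 2)) / K) := by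
          rw [← Finset.sum_div, mul_div_assoc]
      _ = expVelocityMoment c w / ENNReal.ofReal K := by
          rw [ENNReal.ofReal_div_of_pos hK]
          rfl
  have hWM : ∀ N (w : Config (N + 1) (Fin 3) T3), ENNReal.ofReal (W N w) ≤ expVelocityMoment c w := by
    intro N w
    refine ENNReal.ofReal_le_ofReal (mul_le_mul_of_nonneg_left (Finset.sum_le_sum fun i _ => ?_) (by positivity))
    refine (min_le_left _ _).trans (Real.exp_le_exp.2 ?_)
    nlinarith [sq_nonneg ‖(w i).2‖, hc.le]
  have hGbdd : ∀ N, ∀ z ∈ (Φ N).good, ∃ B : ℝ, ∀ s, G N ((Φ N).flow s z) ≤ B := by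
    intro N z hz
    refine ⟨Real.exp (c / 2 * (2 * configEnergy z)), fun s => ?_⟩
    have h := AprioriBoundsNegative.expAvg_le_exp_lam_energy (N := N) (lam := c / 2) (by positivity)
      ((Φ N).flow s z)
    rw [(Φ N).configEnergy_flow hz s] at h
    exact h
  -- the means `e N s = E W_N(Φ_s ·)` and their properties
  set e : ℕ → ℝ → ℝ := fun N s => ∫ z, W N ((Φ N).flow s z) ∂P N with he
  have hXint : ∀ N s, Integrable (fun z => W N ((Φ N).flow s z)) (P N) := fun N s =>
    integrable_of_mem_Icc ((hWm N).comp ((Φ N).measurable_flow s)) (fun z => hW0 N _) (fun z => hWK N _)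
  have he0 : ∀ N s, 0 ≤ e N s := fun N s => integral_nonneg fun z => hW0 N _
  have heK : ∀ N s, e N s ≤ K := by
    intro N s
    calc e N s ≤ ∫ _z, K ∂P N := integral_mono (hXint N s) (integrable_const K) fun z => hWK N _
      _ = K := by rw [integral_const, probReal_univ, one_smul]
  have he_lint : ∀ N s, ENNReal.ofReal (e N s) = ∫⁻ z, ENNReal.ofReal (W N ((Φ N).flow s z)) ∂P N :=
    fun N s => ofReal_integral_eq_lintegral_ofReal (hXint N s) (ae_of_all _ fun z => hW0 N _)
  have heC : ∀ N, N₀ ≤ N → ∀ s ∈ Icc 0 t, e N s ≤ C.toReal := by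
    intro N hN s hs
    have h1 : ENNReal.ofReal (e N s) ≤ C := by
      rw [he_lint]
      exact (lintegral_mono fun z => hWM N _).trans (htails N hN s hs)
    exact (ENNReal.ofReal_le_iff_le_toReal hC.ne).1 h1
  have he_aem : ∀ N, AEMeasurable (e N) ν := by
    intro N
    have hprodW : AEMeasurable
        (fun p : Config (N + 1) (Fin 3) T3 × ℝ => ENNReal.ofReal (W N ((Φ N).flow p.2 p.1))) ((P N).prod ν) :=
      aemeasurable_comp_flow_prod₂ (Φ N) ((hWm N).ennreal_ofReal.comp measurable_fst) (hgood0 N) ν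
    refine hprodW.lintegral_prod_left'.ennreal_toReal.congr (ae_of_all _ fun s => ?_)
    simp only
    rw [← he_lint, ENNReal.toReal_ofReal (he0 N s)]
  -- the centred `L¹` errors `H N s` and their properties
  set H : ℕ → ℝ → ℝ≥0∞ := fun N s => ∫⁻ z, ENNReal.ofReal |W N ((Φ N).flow s z) - e N s| ∂P N with hH
  have hHK : ∀ N s, H N s ≤ ENNReal.ofReal K := by
    intro N s
    calc H N s ≤ ∫⁻ _z, ENNReal.ofReal K ∂P N := lintegral_mono fun z => ENNReal.ofReal_le_ofReal
            (abs_sub_le_iff.2 ⟨by linarith [hWK N ((Φ N).flow s z), he0 N s],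
              by linarith [hW0 N ((Φ N).flow s z), heK N s]⟩)
      _ = ENNReal.ofReal K := by rw [lintegral_const, measure_univ, mul_one]
  have hHm : ∀ N, AEMeasurable (H N) ν := fun N =>
    (((aemeasurable_real_comp_flow_prod (Φ N) (hWm N) (hgood0 N) ν).sub
      (he_aem N).comp_snd).abs.ennreal_ofReal).lintegral_prod_left'
  have hHlim : ∀ s ∈ Icc 0 t, Tendsto (fun N => H N s) atTop (𝓝 0) := by
    intro s hs
    obtain ⟨m, hm⟩ := hlln K s hs
    have hm' : ∀ δ : ℝ, 0 < δ →
        Tendsto (fun N => P N {z | δ < |W N ((Φ N).flow s z) - m|}) atTop (𝓝 0) := by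
      intro δ hδ
      have h := hm δ hδ
      simp only [hWemp] at h
      exact h
    have hA := tendsto_lintegral_abs_sub_const P (fun N z => W N ((Φ N).flow s z))
      (fun N => (hWm N).comp ((Φ N).measurable_flow s)) (fun N z => hW0 N _) (fun N z => hWK N _) m hm'
    have h2A : Tendsto (fun N => 2 * ∫⁻ z, ENNReal.ofReal |W N ((Φ N).flow s z) - m| ∂P N) atTop (𝓝 0) := by
      have h := ENNReal.Tendsto.const_mul (a := 2) hA (Or.inr ENNReal.ofNat_ne_top)
      rwa [mul_zero] at h
    refine tendsto_of_tendsto_of_tendsto_of_le_of_le tendsto_const_nhds h2A (fun _ => bot_le) fun N => ?_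
    exact lintegral_abs_sub_integral_le (hXint N s) m
  have hI : Tendsto (fun N => ∫⁻ s in Icc 0 t, H N s) atTop (𝓝 0) :=
    tendsto_setLIntegral_Icc_of_dominated H hHm (fun N => ae_of_all _ fun s => hHK N s)
      ((ae_restrict_iff' measurableSet_Icc).2 (ae_of_all _ fun s hs => hHlim s hs))
  -- conclusion: for `N ≥ N₀` with `∫₀ᵗ H_N ≤ ε/2`
  filter_upwards [eventually_ge_atTop N₀, ENNReal.tendsto_nhds_zero.1 hI (ε / 2) (ENNReal.half_pos hε.ne')]
    with N hN hIN
  have hev : {z : Config (N + 1) (Fin 3) T3 | t * C.toReal + 1 < ∫ s in Icc 0 t,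
      ∫ y, Real.exp (c / 2 * ‖y.2‖ ^ 2) ∂(empiricalMeasure ((Φ N).flow s z))} =
      {z | t * C.toReal + 1 < ∫ s in Icc 0 t, G N ((Φ N).flow s z)} := by
    ext z
    simp only [mem_setOf_eq, hGemp]
  rw [hev]
  have hmain := measure_timeAvg_gt_le_of_trunc (Φ N) (P N) (hprob N) (hgood0 N) (hGm N) (hWm N) (hMm N) ht
    (C := C) (hW0 N) (hWK N) (hWG N) (hrem N) (hGbdd N) (fun s hs => htails N hN s hs) (he_aem N) (he0 N)
    (heK N) (heC N hN)
  calc P N {z | t * C.toReal + 1 < ∫ s in Icc 0 t, G N ((Φ N).flow s z)}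
      ≤ (∫⁻ s in Icc 0 t, H N s) + C / ENNReal.ofReal K * ENNReal.ofReal t := hmain
    _ ≤ ε / 2 + ε / 2 := add_le_add hIN hCK
    _ = ε := ENNReal.add_halves ε

end Summit.AtomisticToContinuum.HydrodynamicLimit.Theorems.AdiabatCeiling
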